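import Mathlib.Combinatorics.Digraph.Basic
import Mathlib.Algebra.Order.Archimedean.Real.Basic
import Mathlib.Data.Fintype.Order
import Mathlib.Order.Filter.AtTopBot.Basic
import Mathlib.Algebra.BigOperators.Group.Finset.Basic
import Mathlib.Algebra.Order.BigOperators.Group.Finset
import Mathlib.Logic.Function.Iterate
import Literature.Computability.Complexity.BoolEncodings
import HarnessLib

/-!
# Mean-payoff games (Ehrenfeucht–Mycielski, Zwick–Paterson)

A *mean-payoff game* is played on a finite directed graph without sinks whose vertices are owned
by two players, Max and Min, and whose edges carry weights. A token is moved along edges forever,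
the owner of the current vertex choosing the next edge; Max wants to maximise
`liminf_n (1/n) Σ_{i<n} w(e_i)`, Min wants to minimise `limsup_n (1/n) Σ_{i<n} w(e_i)`.
Ehrenfeucht and Mycielski proved that every vertex `a` has a value `ν(a)` which both players can
secure with *positional* (memoryless) strategies [EhrenfeuchtMycielski1979; restated in
ZwickPaterson1995 §1 and, for owner-labelled arenas with real weights, Schewe2009 §2 Prop. 1];
Zwick and Paterson showed that the decision problem "`ν(a) ≥ ν`?" is in `NP ∩ coNP` and solvable
in pseudo-polynomial time [ZwickPaterson1995, Thms 3, 4, 7; journal version ZwickPaterson1996].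

## Contents

* `MeanPayoffGame V R`: an arena = a `Digraph V` with an owner map `owner : V → Bool`
  (`true` = Max) and weights `weight : V → V → R` (values on non-edges are irrelevant junk);
  `IsTotal` (no sinks), `map` (change of weights, e.g. `ℤ → ℝ`).
* strategies: general strategies `s : List V → V → V` (strict past, current vertex ↦ next
  vertex), `IsStrategy`, positional ones `IsPositional` / `positional`, plays `IsPlay`,
  conformance `Conforms`, the play `play σ τ v` of a pair of positional strategies, partial sums
  `partialSum`.
* objectives over `ℝ`: `SecuresGe s v ν` (every play from `v` conforming to Max's `s` has
  `liminf` mean payoff `≥ ν`, in the division-free `ε`-form `∀ ε > 0, ∀ᶠ n, (ν - ε)·n ≤ Σ_{i<n} w`),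
  dually `SecuresLe`, and `ValueGe v ν` ("Max can secure `ν` from `v`", which by positional
  determinacy is the decision problem `ν(v) ≥ ν` of [ZwickPaterson1995, Thm 7]).
* the named fact `EhrenfeuchtMycielski1979_positionalDeterminacy` (not proved here).
* the POTENTIAL CERTIFICATE `NonnegCert G v` for "`ν(v) ≥ 0`": a positional choice `σ` of Max, a
  set `S ∋ v` closed under `σ` at Max vertices and under all edges at Min vertices, and a
  potential `π` with `π u' ≤ π u + w(u,u')` on those edges (a feasible potential = "no negative
  cycle" certificate of shortest-path theory, alias an energy progress measure); PROVED here: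
  such a certificate yields a positional strategy of Max securing mean payoff `≥ 0`
  (`NonnegCert.exists_isPositional_securesGe`, telescoping). The converse (from positional
  determinacy and shortest-path potentials on the finite graph `G_σ`) is not proved here.
* the two concrete encodings used by route PneNP/NoTardosTropics (last section):
  `MeanPayoffGame.ofRealVector k g` reads an arena on `Fin k` off a coordinate function
  `g : ℕ → ℝ` (`k` owner bits, `k²` edge indicators, `k²` weights); `MPGPred k g` is the route's
  yes-predicate verbatim and `mpgPred_iff : MPGPred k g ↔ IsTotal ∧ NonnegCert ⟨0, _⟩`;
  `MPGReal : (n : ℕ) → Set (Fin n → ℝ)` (real inputs, `n = k + 2k²`, `k ≥ 1`, start vertex `0`)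
  and `MPGBoolSet` / `MPGBool : Language Bool` (integer instances `[k, owners, indicators,
  weights]` under `encodingIntBool.listBool`) are BY DEFINITION the terms inlined in the route's
  items (`XAdd`, `NoTropicalTardos`, `FKLoweringMPG`, `MPGRealMemNDPadd`, `BooleanShadow`,
  `MadHNonuniform`), so those restate over the names by `rfl`; `mem_MPGReal_iff` /
  `mem_MPGBoolSet_iff` are the structured readings.

## Not here

Parity games and Jurdziński's reduction to mean-payoff games; the Zwick–Paterson value
iteration and the `NP ∩ coNP` membership of `MPGBool` as a statement about Turing machines;
discounted and simple stochastic games.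

## References

* A. Ehrenfeucht, J. Mycielski, *Positional strategies for mean payoff games*, Int. J. Game
  Theory 8 (1979) 109–113.
* U. Zwick, M. S. Paterson, *The complexity of mean payoff games*, COCOON 1995, LNCS 959, 1–10
  (§1: definitions; Thm 7: NP ∩ coNP); journal version Theoret. Comput. Sci. 158 (1996) 343–359.
* S. Schewe, *From parity and payoff games to linear programming*, MFCS 2009, LNCS 5734,
  675–686, §2 (arenas, memoryless strategies, real-valued mean payoff games, Prop. 1).
* V. A. Gurvich, A. V. Karzanov, L. G. Khachiyan, USSR Comput. Math. Math. Phys. 28 (1988) 85–91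
  (cyclic games, potential transformations).
-/

namespace Literature.Computability.Complexity

open _root_.Computability Filter

/-- A **mean-payoff game** (arena with weights) on the vertex type `V` with weights in `R`:
a directed graph `Adj` (from `Digraph V`), an owner map (`owner u = true` means that Max moves
at `u`, `false` that Min moves) and edge weights `weight u u'` (only the values on edges
matter). The game `(V_max, V_min, E, w)` of [Schewe2009, §2]; Ehrenfeucht–Mycielski and
Zwick–Paterson let the players alternate on a bipartite graph, which is the special case
`owner` = side. [cite: ZwickPaterson1995, §1] -/
structure MeanPayoffGame (V : Type*) (R : Type*) extends Digraph V where
  /-- `owner u = true`: Max chooses the out-edge at `u`; `false`: Min does. -/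
  owner : V → Bool
  /-- the weight of the edge `u → u'` (junk on non-edges). -/
  weight : V → V → R

namespace MeanPayoffGame

variable {V : Type*} {R : Type*} {R' : Type*}

/-- The arena has no sinks: every vertex has an out-edge ("each vertex has at least one edge
going out of it"). [cite: ZwickPaterson1995, §1] -/
def IsTotal (G : MeanPayoffGame V R) : Prop :=
  ∀ u : V, ∃ u' : V, G.Adj u u'

section Combinatorial

variable (G : MeanPayoffGame V R)

/-- Change of weights along `f : R → R'` (same graph, same owners), e.g. the real game of an
integer-weighted game. [folklore] -/
def map (f : R → R') : MeanPayoffGame V R' where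
  Adj := G.Adj
  owner := G.owner
  weight u u' := f (G.weight u u')

/-- `map` keeps the edges. [folklore] -/
@[simp] theorem map_adj (f : R → R') (u u' : V) : (G.map f).Adj u u' ↔ G.Adj u u' := Iff.rfl

/-- `map` keeps the owners. [folklore] -/
@[simp] theorem map_owner (f : R → R') : (G.map f).owner = G.owner := rfl

/-- `map` applies `f` to every weight. [folklore] -/
@[simp] theorem map_weight (f : R → R') (u u' : V) :
    (G.map f).weight u u' = f (G.weight u u') := rfl

/-- `map` keeps totality. [folklore] -/
@[simp] theorem isTotal_map_iff (f : R → R') : (G.map f).IsTotal ↔ G.IsTotal := Iff.rfl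

/-- A (general, deterministic) **strategy** is a map `s : List V → V → V`: given the strict
past `[ρ 0, …, ρ (i-1)]` and the current vertex `ρ i` it names the next vertex. `s` is a
strategy *of player `p`* in `G` when it always proposes an out-edge at `p`'s vertices (its
values elsewhere are irrelevant). [cite: ZwickPaterson1995, §1] -/
def IsStrategy (p : Bool) (s : List V → V → V) : Prop :=
  ∀ (past : List V) (u : V), G.owner u = p → G.Adj u (s past u)

/-- A **positional** (memoryless) strategy of player `p`: a map `σ : V → V` choosing an
out-edge at every vertex owned by `p` ("the next move depends only on the vertex from which
the player is to move"; values at the opponent's vertices are irrelevant).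
[cite: ZwickPaterson1995, §1–§2] -/
def IsPositional (p : Bool) (σ : V → V) : Prop :=
  ∀ u : V, G.owner u = p → G.Adj u (σ u)

/-- The general strategy induced by a positional one (it ignores the past). [folklore] -/
def positional (σ : V → V) : List V → V → V := fun _ u => σ u

/-- Unfolding `positional`. [folklore] -/
@[simp] theorem positional_apply (σ : V → V) (past : List V) (u : V) :
    positional σ past u = σ u := rfl

/-- `positional σ` is a strategy of `p` iff `σ` is a positional strategy of `p`. [folklore] -/
theorem isStrategy_positional_iff (p : Bool) (σ : V → V) :
    G.IsStrategy p (positional σ) ↔ G.IsPositional p σ :=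
  ⟨fun h u hu => h [] u hu, fun h _ u hu => h u hu⟩

/-- A **play**: an infinite path `ρ 0 → ρ 1 → ⋯` in the arena. [cite: Schewe2009, §2] -/
def IsPlay (ρ : ℕ → V) : Prop :=
  ∀ i : ℕ, G.Adj (ρ i) (ρ (i + 1))

/-- The play `ρ` **conforms** to the strategy `s` of player `p`: at every visited `p`-vertex the
next vertex is the one `s` names (given the strict past). [cite: Schewe2009, §2] -/
def Conforms (p : Bool) (s : List V → V → V) (ρ : ℕ → V) : Prop :=
  ∀ i : ℕ, G.owner (ρ i) = p → ρ (i + 1) = s ((List.range i).map ρ) (ρ i)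

/-- Conformance to a positional strategy: `ρ (i+1) = σ (ρ i)` at `p`'s vertices. [folklore] -/
theorem conforms_positional_iff (p : Bool) (σ : V → V) (ρ : ℕ → V) :
    G.Conforms p (positional σ) ρ ↔ ∀ i : ℕ, G.owner (ρ i) = p → ρ (i + 1) = σ (ρ i) :=
  Iff.rfl

/-- The one-step move map of a pair of positional strategies (`σ` for Max, `τ` for Min).
[folklore] -/
def step (σ τ : V → V) (w : V) : V :=
  if G.owner w = true then σ w else τ w

/-- The play from `v` in which Max follows the positional `σ` and Min the positional `τ`
(iterate `step`); it is ultimately periodic ("lasso"). [cite: ZwickPaterson1995, §1] -/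
def play (σ τ : V → V) (v : V) : ℕ → V := fun t => (G.step σ τ)^[t] v

/-- The play starts at `v`. [folklore] -/
@[simp] theorem play_zero (σ τ : V → V) (v : V) : G.play σ τ v 0 = v := rfl

/-- One more step of the play is one application of `step`. [folklore] -/
theorem play_succ (σ τ : V → V) (v : V) (t : ℕ) :
    G.play σ τ v (t + 1) = G.step σ τ (G.play σ τ v t) :=
  Function.iterate_succ_apply' (G.step σ τ) t v

/-- The play of two legal positional strategies is a play of the arena. [folklore] -/
theorem isPlay_play {σ τ : V → V} (hσ : G.IsPositional true σ) (hτ : G.IsPositional false τ)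
    (v : V) : G.IsPlay (G.play σ τ v) := by
  intro i
  rw [play_succ]
  unfold step
  cases h : G.owner (G.play σ τ v i)
  · simpa using hτ _ h
  · simpa using hσ _ h

/-- In `play σ τ v` Max follows `σ`. [folklore] -/
theorem conforms_play_max (σ τ : V → V) (v : V) :
    G.Conforms true (positional σ) (G.play σ τ v) := by
  intro i hi
  rw [play_succ, positional_apply]
  simp [step, hi]

/-- In `play σ τ v` Min follows `τ`. [folklore] -/
theorem conforms_play_min (σ τ : V → V) (v : V) :
    G.Conforms false (positional τ) (G.play σ τ v) := by
  intro i hi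
  rw [play_succ, positional_apply]
  simp [step, hi]

/-- The total weight `Σ_{i<n} w(ρ i, ρ (i+1))` of the first `n` edges of a play.
[cite: ZwickPaterson1995, §1] -/
def partialSum [AddCommMonoid R] (ρ : ℕ → V) (n : ℕ) : R :=
  ∑ i ∈ Finset.range n, G.weight (ρ i) (ρ (i + 1))

/-- The empty partial sum. [folklore] -/
@[simp] theorem partialSum_zero [AddCommMonoid R] (ρ : ℕ → V) : G.partialSum ρ 0 = 0 := by
  simp [partialSum]

/-- `Σ_{i<n+1} = Σ_{i<n} + w(ρ n, ρ (n+1))`. [folklore] -/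
theorem partialSum_succ [AddCommMonoid R] (ρ : ℕ → V) (n : ℕ) :
    G.partialSum ρ (n + 1) = G.partialSum ρ n + G.weight (ρ n) (ρ (n + 1)) := by
  simp [partialSum, Finset.sum_range_succ]

/-- **Potential certificate for "value `≥ 0`" at `v`** (the yes-predicate of route
PneNP/NoTardosTropics): a positional choice `σ` of Max, a set `S` of vertices containing `v`
that is closed under `σ` at Max vertices and under *all* edges at Min vertices, and a potential
`π : V → R` with `π u' ≤ π u + w(u,u')` along all those edges. Feasible potentials exist iff the
relevant subgraph of `G_σ` has no negative cycle (shortest-path duality), so on a finite total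
arena this says: Max has a positional strategy all of whose reachable cycles from `v` are
non-negative, i.e. (positional determinacy) `ν(v) ≥ 0`. Sound half proved below
(`NonnegCert.exists_isPositional_securesGe`). [folklore] -/
def NonnegCert [LE R] [Add R] (v : V) : Prop :=
  ∃ (σ : V → V) (S : Set V) (π : V → R), v ∈ S ∧ ∀ u ∈ S,
    (G.owner u = true → G.Adj u (σ u) ∧ σ u ∈ S ∧ π (σ u) ≤ π u + G.weight u (σ u)) ∧
    (G.owner u = false → ∀ u' : V, G.Adj u u' → u' ∈ S ∧ π u' ≤ π u + G.weight u u')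

/-- Certificate form of the general threshold problem "`ν(v) ≥ c`" of [ZwickPaterson1995, Thm 7]:
shift all weights by `-c` (the mean payoff of every play shifts by `-c`). [folklore] -/
def ThresholdCert [LE R] [AddGroup R] (c : R) (v : V) : Prop :=
  (G.map fun w => w - c).NonnegCert v

/-- Threshold `0` is the plain certificate. [folklore] -/
theorem thresholdCert_zero [AddGroup R] [LE R] (v : V) :
    G.ThresholdCert 0 v ↔ G.NonnegCert v := by
  simp only [ThresholdCert, NonnegCert, map_adj, map_owner, map_weight, sub_zero]

end Combinatorial

section RealObjectives

variable (G : MeanPayoffGame V ℝ)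

/-- Max's strategy `s` **secures mean payoff `≥ ν` from `v`**: every play from `v` that conforms
to `s` (Min moving arbitrarily along edges) has `liminf_n (1/n) Σ_{i<n} w ≥ ν`, written in the
equivalent division-free form `∀ ε > 0, ∀ᶠ n, (ν - ε)·n ≤ Σ_{i<n} w`.
[cite: ZwickPaterson1995, §1] -/
def SecuresGe (s : List V → V → V) (v : V) (ν : ℝ) : Prop :=
  ∀ ρ : ℕ → V, ρ 0 = v → G.IsPlay ρ → G.Conforms true s ρ →
    ∀ ε : ℝ, 0 < ε → ∀ᶠ n : ℕ in atTop, (ν - ε) * n ≤ G.partialSum ρ n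

/-- Min's strategy `t` **secures mean payoff `≤ ν` from `v`**: every play from `v` conforming to
`t` has `limsup_n (1/n) Σ_{i<n} w ≤ ν`, i.e. `∀ ε > 0, ∀ᶠ n, Σ_{i<n} w ≤ (ν + ε)·n`.
[cite: ZwickPaterson1995, §1] -/
def SecuresLe (t : List V → V → V) (v : V) (ν : ℝ) : Prop :=
  ∀ ρ : ℕ → V, ρ 0 = v → G.IsPlay ρ → G.Conforms false t ρ →
    ∀ ε : ℝ, 0 < ε → ∀ᶠ n : ℕ in atTop, G.partialSum ρ n ≤ (ν + ε) * n

/-- **"Max can secure `ν` from `v`"**: some strategy of Max secures mean payoff `≥ ν` from `v`.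
By positional determinacy (`EhrenfeuchtMycielski1979_positionalDeterminacy`) this is the
decision problem "is the value of the game started at `v` at least `ν`?" of
[ZwickPaterson1995, Thm 7], and a positional `s` suffices.
[cite: ZwickPaterson1995, §1 and Thm 7] -/
def ValueGe (v : V) (ν : ℝ) : Prop :=
  ∃ s : List V → V → V, G.IsStrategy true s ∧ G.SecuresGe s v ν

/-- Securing `≥ ν` secures `≥ ν'` for every `ν' ≤ ν`. [folklore] -/
theorem SecuresGe.mono {G : MeanPayoffGame V ℝ} {s : List V → V → V} {v : V} {ν ν' : ℝ}
    (h : G.SecuresGe s v ν) (hle : ν' ≤ ν) : G.SecuresGe s v ν' := by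
  intro ρ h0 hplay hconf ε hε
  filter_upwards [h ρ h0 hplay hconf ε hε] with n hn
  have : (ν' - ε) * (n : ℝ) ≤ (ν - ε) * n :=
    mul_le_mul_of_nonneg_right (sub_le_sub_right hle ε) (Nat.cast_nonneg n)
  exact this.trans hn

/-- `ValueGe v` is downward closed in the threshold. [folklore] -/
theorem ValueGe.mono {G : MeanPayoffGame V ℝ} {v : V} {ν ν' : ℝ} (h : G.ValueGe v ν)
    (hle : ν' ≤ ν) : G.ValueGe v ν' := by
  obtain ⟨s, hs, hsec⟩ := h
  exact ⟨s, hs, hsec.mono hle⟩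

end RealObjectives

section Soundness

variable {G : MeanPayoffGame V ℝ}

/-- Along a play that stays inside the certified set and respects the certificate, the
potential inequality holds at every step. Auxiliary form: membership and the one-step
inequality, by induction along the play. [folklore] -/
theorem NonnegCert.mem_and_step {σ : V → V} {S : Set V} {π : V → ℝ}
    (hS : ∀ u ∈ S,
      (G.owner u = true → G.Adj u (σ u) ∧ σ u ∈ S ∧ π (σ u) ≤ π u + G.weight u (σ u)) ∧
      (G.owner u = false → ∀ u' : V, G.Adj u u' → u' ∈ S ∧ π u' ≤ π u + G.weight u u'))
    {ρ : ℕ → V} (h0 : ρ 0 ∈ S) (hplay : G.IsPlay ρ)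
    (hconf : ∀ i : ℕ, G.owner (ρ i) = true → ρ i ∈ S → ρ (i + 1) = σ (ρ i)) :
    ∀ i : ℕ, ρ i ∈ S ∧ π (ρ (i + 1)) ≤ π (ρ i) + G.weight (ρ i) (ρ (i + 1)) := by
  intro i
  induction i with
  | zero =>
    refine ⟨h0, ?_⟩
    cases h : G.owner (ρ 0)
    · exact ((hS _ h0).2 h _ (hplay 0)).2
    · rw [hconf 0 h h0]
      exact ((hS _ h0).1 h).2.2
  | succ i ih =>
    have hmem : ρ (i + 1) ∈ S := by
      cases h : G.owner (ρ i)
      · exact ((hS _ ih.1).2 h (ρ (i + 1)) (hplay i)).1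
      · rw [hconf i h ih.1]
        exact ((hS _ ih.1).1 h).2.1
    refine ⟨hmem, ?_⟩
    cases h : G.owner (ρ (i + 1))
    · exact ((hS _ hmem).2 h (ρ (i + 1 + 1)) (hplay (i + 1))).2
    · rw [hconf (i + 1) h hmem]
      exact ((hS _ hmem).1 h).2.2

/-- Telescoping: under the hypotheses of `NonnegCert.mem_and_step`,
`π (ρ n) - π (ρ 0) ≤ Σ_{i<n} w(ρ i, ρ (i+1))`. [folklore] -/
theorem NonnegCert.sub_le_partialSum {σ : V → V} {S : Set V} {π : V → ℝ}
    (hS : ∀ u ∈ S,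
      (G.owner u = true → G.Adj u (σ u) ∧ σ u ∈ S ∧ π (σ u) ≤ π u + G.weight u (σ u)) ∧
      (G.owner u = false → ∀ u' : V, G.Adj u u' → u' ∈ S ∧ π u' ≤ π u + G.weight u u'))
    {ρ : ℕ → V} (h0 : ρ 0 ∈ S) (hplay : G.IsPlay ρ)
    (hconf : ∀ i : ℕ, G.owner (ρ i) = true → ρ i ∈ S → ρ (i + 1) = σ (ρ i)) (n : ℕ) :
    π (ρ n) - π (ρ 0) ≤ G.partialSum ρ n := by
  induction n with
  | zero => simp
  | succ n ih =>
    rw [partialSum_succ]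
    have := (NonnegCert.mem_and_step hS h0 hplay hconf n).2
    linarith

/-- **Soundness of the potential certificate.** On a finite arena without sinks, a potential
certificate at `v` yields a legal POSITIONAL strategy of Max securing mean payoff `≥ 0` from
`v`: plays conforming to `σ` never leave `S`, the potential telescopes, and `π` is bounded on the
finite vertex set, so `Σ_{i<n} w ≥ -2·max|π|` for all `n`. (Outside `S` the strategy is patched
with arbitrary out-edges, which such plays never use.) [folklore] -/
theorem NonnegCert.exists_isPositional_securesGe [Finite V] (hG : G.IsTotal) {v : V}
    (h : G.NonnegCert v) :
    ∃ σ : V → V, G.IsPositional true σ ∧ G.SecuresGe (positional σ) v 0 := by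
  classical
  obtain ⟨σ, S, π, hv, hS⟩ := h
  let σ' : V → V := fun u => if u ∈ S then σ u else (hG u).choose
  have hσ'S : ∀ u ∈ S, σ' u = σ u := fun u hu => if_pos hu
  have hσ'out : ∀ u ∉ S, σ' u = (hG u).choose := fun u hu => if_neg hu
  refine ⟨σ', ?_, ?_⟩
  · intro u hu
    by_cases hmem : u ∈ S
    · rw [hσ'S u hmem]
      exact ((hS u hmem).1 hu).1
    · rw [hσ'out u hmem]
      exact (hG u).choose_spec
  · intro ρ h0 hplay hconf ε hε
    have h0' : ρ 0 ∈ S := h0 ▸ hv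
    have hconf' : ∀ i : ℕ, G.owner (ρ i) = true → ρ i ∈ S → ρ (i + 1) = σ (ρ i) := by
      intro i hi hmem
      rw [(G.conforms_positional_iff true σ' ρ).1 hconf i hi, hσ'S _ hmem]
    obtain ⟨C, hC⟩ := Finite.exists_le fun u : V => |π u|
    obtain ⟨N, hN⟩ := exists_nat_ge (2 * C / ε)
    refine eventually_atTop.2 ⟨N, fun n hn => ?_⟩
    have h1 : π (ρ n) - π (ρ 0) ≤ G.partialSum ρ n :=
      NonnegCert.sub_le_partialSum hS h0' hplay hconf' n
    have h2 : -C ≤ π (ρ n) := (abs_le.1 (hC (ρ n))).1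
    have h3 : π (ρ 0) ≤ C := (abs_le.1 (hC (ρ 0))).2
    have h4 : 2 * C ≤ ε * N := by
      have := (div_le_iff₀ hε).1 hN
      linarith [mul_comm (N : ℝ) ε]
    have h5 : (N : ℝ) ≤ n := Nat.cast_le.2 hn
    calc (0 - ε) * (n : ℝ) = -(ε * n) := by ring
      _ ≤ -(ε * N) := neg_le_neg (mul_le_mul_of_nonneg_left h5 hε.le)
      _ ≤ π (ρ n) - π (ρ 0) := by linarith
      _ ≤ G.partialSum ρ n := h1

/-- Hence a potential certificate at `v` implies that Max can secure `0` from `v`.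
[folklore] -/
theorem NonnegCert.valueGe_zero [Finite V] (hG : G.IsTotal) {v : V} (h : G.NonnegCert v) :
    G.ValueGe v 0 := by
  obtain ⟨σ, hσ, hsec⟩ := h.exists_isPositional_securesGe hG
  exact ⟨positional σ, (G.isStrategy_positional_iff true σ).2 hσ, hsec⟩

end Soundness

end MeanPayoffGame

/-- **Ehrenfeucht–Mycielski positional determinacy of mean-payoff games.** On a finite arena
without sinks, for every start vertex `v` there is a value `ν` together with POSITIONAL
strategies `σ` of Max and `τ` of Min such that every play from `v` conforming to `σ` has
`liminf` mean payoff `≥ ν` and every play from `v` conforming to `τ` has `limsup` mean payoff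
`≤ ν` ("each such game has a value ν …; furthermore both players can achieve this value using a
positional strategy"). Stated for real weights and owner-labelled arenas as in
[Schewe2009, §2 Prop. 1] (the original lets the players alternate on a bipartite graph, the
special case `owner` = side). Named fact, not proved here.
[cite: EhrenfeuchtMycielski1979, main thm; restated ZwickPaterson1995 §1, Schewe2009 §2 Prop 1] -/
def EhrenfeuchtMycielski1979_positionalDeterminacy : Prop :=
  ∀ (k : ℕ) (G : MeanPayoffGame (Fin k) ℝ), G.IsTotal → ∀ v : Fin k,
    ∃ (ν : ℝ) (σ τ : Fin k → Fin k), G.IsPositional true σ ∧ G.IsPositional false τ ∧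
      G.SecuresGe (MeanPayoffGame.positional σ) v ν ∧
      G.SecuresLe (MeanPayoffGame.positional τ) v ν

/-! ### The encodings of route PneNP/NoTardosTropics -/

section Encodings

/-- The arena on `Fin k` read off a real-valued coordinate function `g` (coordinates beyond the
intended range are junk): owner bit of `u` at `g u` (`= 1` ↔ Max), edge indicator of `u → u'`
at `g (k + (u·k + u'))` (`= 1` ↔ edge), weight of `u → u'` at `g (k + k·k + (u·k + u'))`.
This is the reading of an input `x ∈ ℝⁿ`, `n = k + 2k²`, used by route PneNP/NoTardosTropics
(with `g m = (List.ofFn x).getD m 0`). [folklore] -/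
noncomputable def MeanPayoffGame.ofRealVector (k : ℕ) (g : ℕ → ℝ) :
    MeanPayoffGame (Fin k) ℝ where
  Adj u u' := g (k + (u.val * k + u'.val)) = 1
  owner u := decide (g u.val = 1)
  weight u u' := g (k + k * k + (u.val * k + u'.val))

/-- The yes-predicate of the route, verbatim, on an arena size `k` and a coordinate function
`g`: the arena read off `g` is total and carries a potential certificate at vertex `0`
(phrased without the dependent `⟨0, _⟩ : Fin k`). [folklore] -/
def MPGPred (k : ℕ) (g : ℕ → ℝ) : Prop :=
  (∀ u : Fin k, ∃ u' : Fin k, g (k + (u.val * k + u'.val)) = 1) ∧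
    ∃ (σ : Fin k → Fin k) (R : Set (Fin k)) (π : Fin k → ℝ), (∃ v ∈ R, v.val = 0) ∧
      ∀ u ∈ R, (g u.val = 1 → g (k + (u.val * k + (σ u).val)) = 1 ∧ σ u ∈ R ∧
          π (σ u) ≤ π u + g (k + k * k + (u.val * k + (σ u).val))) ∧
        (g u.val ≠ 1 → ∀ u' : Fin k, g (k + (u.val * k + u'.val)) = 1 →
          u' ∈ R ∧ π u' ≤ π u + g (k + k * k + (u.val * k + u'.val)))

/-- `MPGPred` is "total arena with a potential certificate at vertex `0`". [folklore] -/
theorem mpgPred_iff (k : ℕ) (hk : 0 < k) (g : ℕ → ℝ) :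
    MPGPred k g ↔ (MeanPayoffGame.ofRealVector k g).IsTotal ∧
      (MeanPayoffGame.ofRealVector k g).NonnegCert ⟨0, hk⟩ := by
  refine and_congr Iff.rfl ?_
  refine exists_congr fun σ => exists_congr fun S => exists_congr fun π => and_congr ?_ ?_
  · constructor
    · rintro ⟨v, hv, hv0⟩
      have hv' : v = ⟨0, hk⟩ := Fin.ext hv0
      exact hv' ▸ hv
    · intro h
      exact ⟨_, h, rfl⟩
  · refine forall₂_congr fun u _ => ?_
    simp only [MeanPayoffGame.ofRealVector, ne_eq, decide_eq_true_eq, decide_eq_false_iff_not]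

/-- **Real-input mean-payoff language** `MPG_ℝ(n) ⊆ ℝⁿ` of route PneNP/NoTardosTropics: `x ∈ ℝⁿ`
with `n = k + 2k²` (`k ≥ 1`) read as `k` owner bits, `k²` edge indicators and `k²` real
weights (`ofRealVector`), such that the arena is total and vertex `0` carries a potential
certificate (`= "ν(0) ≥ 0"` by positional determinacy; interpretation only). By definition the
term inlined in the route's items (`mem_MPGReal_iff_mpgPred` is `Iff.rfl`). [folklore] -/
def MPGReal (n : ℕ) : Set (Fin n → ℝ) :=
  {x | let g : ℕ → ℝ := fun m => (List.ofFn x).getD m 0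
    ∃ k : ℕ, 0 < k ∧ n = k + 2 * k * k ∧ MPGPred k g}

/-- `x ∈ MPGReal n` unfolds, by `Iff.rfl`, to the route's inline term. [folklore] -/
theorem mem_MPGReal_iff_mpgPred {n : ℕ} (x : Fin n → ℝ) :
    x ∈ MPGReal n ↔
      ∃ k : ℕ, 0 < k ∧ n = k + 2 * k * k ∧ MPGPred k (fun m => (List.ofFn x).getD m 0) :=
  Iff.rfl

/-- Structured reading of `MPGReal`: total arena plus potential certificate at vertex `0`.
[folklore] -/
theorem mem_MPGReal_iff {n : ℕ} (x : Fin n → ℝ) :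
    x ∈ MPGReal n ↔ ∃ (k : ℕ) (hk : 0 < k), n = k + 2 * k * k ∧
      (MeanPayoffGame.ofRealVector k (fun m => (List.ofFn x).getD m 0)).IsTotal ∧
      (MeanPayoffGame.ofRealVector k (fun m => (List.ofFn x).getD m 0)).NonnegCert ⟨0, hk⟩ :=
  by
  rw [mem_MPGReal_iff_mpgPred]
  refine exists_congr fun k => ?_
  constructor
  · rintro ⟨hk, hn, hP⟩
    exact ⟨hk, hn, (mpgPred_iff k hk _).1 hP⟩
  · rintro ⟨hk, hn, hP⟩
    exact ⟨hk, hn, (mpgPred_iff k hk _).2 hP⟩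

/-- The set of **integer instances**: lists `[k, owner₀, …, owner_{k-1}, k² edge indicators,
k² weights]` (length `1 + k + 2k²`, head `= k ≥ 1`) whose arena, read with the integers cast to
`ℝ`, is total with a potential certificate at vertex `0` (real potentials; for integer weights
an integer potential exists whenever a real one does, by shortest-path integrality — not proved
here). By definition the set inlined in the route's items `NoTropicalTardos` / `BooleanShadow`.
[folklore] -/
def MPGBoolSet : Set (List ℤ) :=
  {l | let g : ℕ → ℝ := fun m => ((l.getD (m + 1) 0 : ℤ) : ℝ)
    ∃ k : ℕ, 0 < k ∧ l.length = 1 + (k + 2 * k * k) ∧ l.getD 0 0 = (k : ℤ) ∧ MPGPred k g}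

/-- **Boolean mean-payoff language** `MPG_𝔹 ⊆ {0,1}*`: the `encodingIntBool.listBool`-image of
`MPGBoolSet` — the decision problem "`ν(0) ≥ 0`?" for integer-weighted games as a `Language Bool`
(in `NP ∩ coNP` by [ZwickPaterson1995, Thm 7]; not proved here). [folklore] -/
def MPGBool : Language Bool :=
  (encodingIntBool.listBool).toLanguage MPGBoolSet

/-- `l ∈ MPGBoolSet` unfolds, by `Iff.rfl`, to the route's inline term. [folklore] -/
theorem mem_MPGBoolSet_iff_mpgPred (l : List ℤ) :
    l ∈ MPGBoolSet ↔ ∃ k : ℕ, 0 < k ∧ l.length = 1 + (k + 2 * k * k) ∧ l.getD 0 0 = (k : ℤ) ∧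
      MPGPred k (fun m => ((l.getD (m + 1) 0 : ℤ) : ℝ)) :=
  Iff.rfl

/-- Structured reading of `MPGBoolSet`. [folklore] -/
theorem mem_MPGBoolSet_iff (l : List ℤ) :
    l ∈ MPGBoolSet ↔ ∃ (k : ℕ) (hk : 0 < k), l.length = 1 + (k + 2 * k * k) ∧
      l.getD 0 0 = (k : ℤ) ∧
      (MeanPayoffGame.ofRealVector k (fun m => ((l.getD (m + 1) 0 : ℤ) : ℝ))).IsTotal ∧
      (MeanPayoffGame.ofRealVector k (fun m => ((l.getD (m + 1) 0 : ℤ) : ℝ))).NonnegCert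
        ⟨0, hk⟩ := by
  rw [mem_MPGBoolSet_iff_mpgPred]
  refine exists_congr fun k => ?_
  constructor
  · rintro ⟨hk, hl, hh, hP⟩
    exact ⟨hk, hl, hh, (mpgPred_iff k hk _).1 hP⟩
  · rintro ⟨hk, hl, hh, hP⟩
    exact ⟨hk, hl, hh, (mpgPred_iff k hk _).2 hP⟩

/-- Membership of an encoded instance in `MPGBool` is membership in `MPGBoolSet`. [folklore] -/
theorem encode_mem_MPGBool_iff (l : List ℤ) :
    (encodingIntBool.listBool).encode l ∈ MPGBool ↔ l ∈ MPGBoolSet :=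
  (encodingIntBool.listBool).mem_toLanguage_iff MPGBoolSet l

end Encodings

end Literature.Computability.Complexity
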